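import Literature.Probability.RandomPlanarGeometry.HexSAWPolygonRatioLowerRate
import Literature.Probability.RandomPlanarGeometry.HexSAWPolygonNumber
import HarnessLib

/-!
# The honeycomb polygon numbers up to translation: Kesten's (7.5.2) with both rates and the growth constant
# `q_{2K}(ℍ)^{1/(2K)} → √(2+√2)`, in the PRINTED normalisation

Topic `Literature/Probability/RandomPlanarGeometry` (lane «pcv-sawmu», a-p4 g8; a corollary sheet of
`HexSAWPolygonRatioLowerRate.lean` — `HV.hexPolygonCountRatioTwo_rate` (both rates for the rooted counts
`hexPolygonCount`) — and `HexSAWPolygonNumber.lean` — `HexBW.hexPolygonNumber` = `q_N(ℍ)`, the dictionary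
`HV.hexPolygonNumber_ratio_eq : q_{2m+4}/q_{2m+2} = ((2m+2)/(2m+4)) · p_{2m+4}/p_{2m+2}`).

Source: N. Madras, G. Slade, *The Self-Avoiding Walk* (1993), §7.5 eq. (7.5.2) p. 255 and Theorem 7.3.4 (c) p. 248 (`ℤ^d`; tree
twin `Zd.MadrasSlade1993_thm734c_rate`, whose `O(1/M)` prefactor bookkeeping is repeated here for `ℍ`).

* **`HV.hexPolygonNumberRatioTwo_rate : ∃ K m₁, ∀ m ≥ m₁, −K·m^(−1/3) ≤ q_{2m+4}(ℍ)/q_{2m+2}(ℍ) − (2+√2) ≤ K·m^(−1/4)`** (NO hypotheses);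
* `HV.tendsto_log_hexPolygonNumber_div`, **`HV.tendsto_hexPolygonNumber_rpow`** / `…_sqrt`: `q_{2K}(ℍ)^{1/(2K)} → μ_ℍ = √(2+√2)`
  (Madras–Slade (3.2.9) on `ℍ` in the printed normalisation; the lane's `tendsto_hexPolygonCount_rpow` is the rooted form).
-/

noncomputable section

open Finset Filter Topology Literature.Probability.LatticeModels SimpleGraph

namespace Literature.Probability.RandomPlanarGeometry.SAW.HV

/-- `1/(m+2) ≤ m^{-1/3}` for `m ≥ 1`. [folklore] -/
private theorem inv_le_rpow_neg_third {m : ℕ} (hm : 1 ≤ m) : (1 : ℝ) / ((m : ℝ) + 2) ≤ (m : ℝ) ^ (-(1 : ℝ) / 3) := by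
  have hmr : (1 : ℝ) ≤ m := by exact_mod_cast hm
  have hm0 : (0 : ℝ) < m := by linarith
  rw [show (-(1 : ℝ) / 3) = -((1 : ℝ) / 3) by ring, Real.rpow_neg hm0.le, ← one_div]
  apply one_div_le_one_div_of_le (Real.rpow_pos_of_pos hm0 _)
  calc (m : ℝ) ^ ((1 : ℝ) / 3) ≤ (m : ℝ) ^ (1 : ℝ) := Real.rpow_le_rpow_of_exponent_le hmr (by norm_num)
    _ = m := Real.rpow_one _
    _ ≤ m + 2 := by linarith

/-- **Kesten's (7.5.2) for honeycomb polygons up to translation, both rates, NO hypotheses**: for all large `m`,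
`−K m^{−1/3} ≤ q_{2m+4}(ℍ)/q_{2m+2}(ℍ) − (2+√2) ≤ K m^{−1/4}` (`q_N(ℍ) = HexBW.hexPolygonNumber N`, the printed `p_N`).
[cite: MadrasSlade1993, §7.5 eq. (7.5.2) p. 255; Theorem 7.3.4 (c) p. 248] [cite: Kesten1963SAW, §4] [cite: DuminilCopinSmirnov2012, Theorem 1] -/
theorem hexPolygonNumberRatioTwo_rate :
    ∃ K : ℝ, ∃ m₁ : ℕ, ∀ m : ℕ, m₁ ≤ m →
      -K * (m : ℝ) ^ (-(1 : ℝ) / 3) ≤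
          (HexBW.hexPolygonNumber (2 * m + 4) : ℝ) / HexBW.hexPolygonNumber (2 * m + 2) - (2 + Real.sqrt 2) ∧
        (HexBW.hexPolygonNumber (2 * m + 4) : ℝ) / HexBW.hexPolygonNumber (2 * m + 2) - (2 + Real.sqrt 2) ≤
          K * (m : ℝ) ^ (-(1 : ℝ) / 4) := by
  obtain ⟨K₁, m₁, hlow⟩ := hexPolygonCountRatioTwo_lowerRate
  obtain ⟨K₂, m₂, hup⟩ := hexPolygonNumberRatioTwo_upperRate
  set L : ℝ := 2 + Real.sqrt 2 with hL
  have hL0 : 0 ≤ L := by positivity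
  refine ⟨max (max K₁ 0 + 2 * L) K₂, max (max m₁ m₂) 1, fun m hm => ⟨?_, ?_⟩⟩
  · have hm1 : 1 ≤ m := le_trans (le_max_right _ _) hm
    have hmm : m₁ ≤ m := le_trans (le_trans (le_max_left _ _) (le_max_left _ _)) hm
    have h := hlow m hmm
    rw [hexPolygonNumber_ratio_eq hm1]
    set ρ : ℝ := (hexPolygonCount (2 * m + 4) : ℝ) / hexPolygonCount (2 * m + 2) with hρ
    set c : ℝ := (2 * m + 2 : ℝ) / (2 * m + 4) with hc
    have hmr : (0 : ℝ) ≤ (m : ℝ) ^ (-(1 : ℝ) / 3) := Real.rpow_nonneg (Nat.cast_nonneg m) _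
    have hc0 : 0 ≤ c := by rw [hc]; positivity
    have hc1 : c ≤ 1 := by rw [hc, div_le_one (by positivity)]; linarith
    have hc' : 1 - c = 1 / ((m : ℝ) + 2) := by
      rw [hc]; field_simp; ring
    have h13 : 1 - c ≤ (m : ℝ) ^ (-(1 : ℝ) / 3) := by rw [hc']; exact inv_le_rpow_neg_third hm1
    -- `c ρ − L = c (ρ − L) − (1 − c) L ≥ −c K₁ m^{-1/3} − (1−c) L ≥ −(max K₁ 0 + 2L) m^{-1/3}`
    have h1 : -(max K₁ 0) * (m : ℝ) ^ (-(1 : ℝ) / 3) ≤ ρ - L := by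
      have : -(max K₁ 0) * (m : ℝ) ^ (-(1 : ℝ) / 3) ≤ -K₁ * (m : ℝ) ^ (-(1 : ℝ) / 3) := by
        have := mul_le_mul_of_nonneg_right (le_max_left K₁ 0) hmr; linarith
      linarith
    have h2 : c * (ρ - L) ≥ -(max K₁ 0) * (m : ℝ) ^ (-(1 : ℝ) / 3) := by
      have hK0 : 0 ≤ max K₁ 0 * (m : ℝ) ^ (-(1 : ℝ) / 3) := mul_nonneg (le_max_right _ _) hmr
      nlinarith
    have h3 : (1 - c) * L ≤ (m : ℝ) ^ (-(1 : ℝ) / 3) * L := mul_le_mul_of_nonneg_right h13 hL0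
    have hmax : (max K₁ 0 + 2 * L) * (m : ℝ) ^ (-(1 : ℝ) / 3) ≤
        max (max K₁ 0 + 2 * L) K₂ * (m : ℝ) ^ (-(1 : ℝ) / 3) := mul_le_mul_of_nonneg_right (le_max_left _ _) hmr
    have : c * ρ - L = c * (ρ - L) - (1 - c) * L := by ring
    rw [this]
    nlinarith
  · have hm2 : m₂ ≤ m := le_trans (le_trans (le_max_right _ _) (le_max_left _ _)) hm
    have hmr : (0 : ℝ) ≤ (m : ℝ) ^ (-(1 : ℝ) / 4) := Real.rpow_nonneg (Nat.cast_nonneg m) _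
    exact (hup m hm2).trans (mul_le_mul_of_nonneg_right (le_max_right _ _) hmr)

/-! ### `μ_polygon(ℍ)` in the printed normalisation: `q_{2K}(ℍ)^{1/(2K)} → μ_ℍ = √(2+√2)` -/

/-- `log q_{2K}(ℍ) / (2K) → log μ_ℍ` (from the lane's `tendsto_log_hexPolygonCount_div` and `2K·q_{2K} = 3·p_{2K}`; the correction
`(log 3 − log 2K)/(2K) → 0`). [cite: MadrasSlade1993, Corollary 3.2.5, eq. (3.2.9), p. 67] -/
theorem tendsto_log_hexPolygonNumber_div :
    Tendsto (fun K : ℕ => Real.log (HexBW.hexPolygonNumber (2 * K)) / (2 * K : ℕ)) atTop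
      (𝓝 (Real.log hexConnectiveConstant)) := by
  -- the identity `log q = log 3 + log p − log (2K)` for `K ≥ 13`
  have hid : ∀ K : ℕ, 13 ≤ K → Real.log (HexBW.hexPolygonNumber (2 * K)) =
      Real.log (hexPolygonCount (2 * K)) + (Real.log 3 - Real.log (2 * K : ℕ)) := by
    intro K hK
    have hp : 0 < (hexPolygonCount (2 * K) : ℝ) := (abs_log_hexPolygonCount_sub_le (N := 2 * K) (by omega) ⟨K, by ring⟩).1
    have hq := HexBW.hexPolygonNumber_eq_hexPolygonCount (N := 2 * K) (by omega)
    have hq' : (((2 * K : ℕ)) : ℝ) * HexBW.hexPolygonNumber (2 * K) = 3 * hexPolygonCount (2 * K) := by exact_mod_cast hq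
    have hKpos : (0 : ℝ) < ((2 * K : ℕ) : ℝ) := by exact_mod_cast (show 0 < 2 * K by omega)
    have hqr : (HexBW.hexPolygonNumber (2 * K) : ℝ) = 3 * hexPolygonCount (2 * K) / ((2 * K : ℕ) : ℝ) := by
      rw [eq_div_iff hKpos.ne']; linarith
    rw [hqr, Real.log_div (by positivity) hKpos.ne', Real.log_mul (by norm_num) hp.ne']
    ring
  have hcorr : Tendsto (fun K : ℕ => (Real.log 3 - Real.log (2 * K : ℕ)) / (2 * K : ℕ)) atTop (𝓝 0) := by
    have hN : Tendsto (fun K : ℕ => ((2 * K : ℕ) : ℝ)) atTop atTop := by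
      exact tendsto_natCast_atTop_atTop.comp (tendsto_atTop_mono (fun K : ℕ => show id K ≤ 2 * K by simp; omega) tendsto_id)
    have h1 : Tendsto (fun K : ℕ => Real.log 3 / ((2 * K : ℕ) : ℝ)) atTop (𝓝 0) := hN.const_div_atTop _
    have h2 : Tendsto (fun K : ℕ => Real.log ((2 * K : ℕ) : ℝ) / ((2 * K : ℕ) : ℝ)) atTop (𝓝 0) := by
      have := Real.tendsto_pow_log_div_mul_add_atTop 1 0 1 one_ne_zero
      simp only [pow_one, one_mul, add_zero] at this
      exact this.comp hN
    have := h1.sub h2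
    rw [sub_zero] at this
    refine this.congr fun K => ?_
    rw [sub_div]
  have hsum := tendsto_log_hexPolygonCount_div.add hcorr
  rw [add_zero] at hsum
  refine hsum.congr' ?_
  filter_upwards [eventually_ge_atTop 13] with K hK
  rw [hid K hK, add_div]

/-- **`μ_polygon(ℍ) = μ_ℍ` in the PRINTED normalisation**: `q_{2K}(ℍ)^{1/(2K)} → μ_ℍ` (Madras–Slade (3.2.9) on `ℍ` for the
polygon numbers up to translation). [cite: MadrasSlade1993, Corollary 3.2.5, eq. (3.2.9), p. 67] -/
theorem tendsto_hexPolygonNumber_rpow :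
    Tendsto (fun K : ℕ => (HexBW.hexPolygonNumber (2 * K) : ℝ) ^ (1 / ((2 * K : ℕ) : ℝ))) atTop (𝓝 hexConnectiveConstant) := by
  have hexp := (Real.continuous_exp.tendsto _).comp tendsto_log_hexPolygonNumber_div
  rw [Real.exp_log hexConnectiveConstant_pos] at hexp
  refine hexp.congr' ?_
  filter_upwards [eventually_ge_atTop 13] with K hK
  have hp : 0 < (hexPolygonCount (2 * K) : ℝ) := (abs_log_hexPolygonCount_sub_le (N := 2 * K) (by omega) ⟨K, by ring⟩).1
  have hq := HexBW.hexPolygonNumber_eq_hexPolygonCount (N := 2 * K) (by omega)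
  have hqpos : 0 < (HexBW.hexPolygonNumber (2 * K) : ℝ) := by
    have hq' : (((2 * K : ℕ)) : ℝ) * HexBW.hexPolygonNumber (2 * K) = 3 * hexPolygonCount (2 * K) := by exact_mod_cast hq
    have hKpos : (0 : ℝ) < ((2 * K : ℕ) : ℝ) := by exact_mod_cast (show 0 < 2 * K by omega)
    nlinarith
  simp only [Function.comp]
  rw [Real.rpow_def_of_pos hqpos]
  congr 1
  rw [div_eq_inv_mul, one_div, mul_comm]

/-- **`q_{2K}(ℍ)^{1/(2K)} → √(2+√2)`** — the honeycomb polygon growth constant in the printed normalisation, with the Duminil-Copin–Smirnov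
value. [cite: MadrasSlade1993, Corollary 3.2.5, eq. (3.2.9), p. 67] [cite: DuminilCopinSmirnov2012, Theorem 1] -/
theorem tendsto_hexPolygonNumber_rpow_sqrt :
    Tendsto (fun K : ℕ => (HexBW.hexPolygonNumber (2 * K) : ℝ) ^ (1 / ((2 * K : ℕ) : ℝ))) atTop
      (𝓝 (Real.sqrt (2 + Real.sqrt 2))) := by
  rw [← hexConnectiveConstant_eq_of_thm1 DuminilCopinSmirnov2012_thm1_holds]
  exact tendsto_hexPolygonNumber_rpow

end Literature.Probability.RandomPlanarGeometry.SAW.HV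

end
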